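import Mathlib
import HarnessLib

/-!
# Bridge sub-goal BR1a of crux `CorkRegluingBudget` (line `registered`, RESHAPE 3): the mollified
# concave profile of the warped symmetric bridge

Registered sub-goal `bridge_profile` of `stub_warpedBridge` (item stmt-SmoothPoincare4-10831).  Pure
real analysis.  The two warped collars of the fill-ins meet along the seam `t = 0` with the
continuous, piecewise-quadratic profile `ψ₀(t) = 1 + 2 μ_C t − K_C t²` (`t ≤ 0`),
`ψ₀(t) = 1 − 2 μ_W t − K_W t²` (`t ≥ 0`), which has a CONCAVE kink at `0` when `μ_C + μ_W ≥ 0`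
(`ψ₀'(0−) = 2μ_C ≥ −2μ_W = ψ₀'(0+)`).  This lemma smooths the kink inside `|t| < δ` keeping the
second derivative below `−2 min(K_C, K_W) + η` (which is what positive scalar curvature of the
warped bridge `dt² + ψ ĥ` needs: `scal = (scal_ĥ − 3ψ'')/ψ`) and keeping `ψ` within `O(δ)` of `1`.
Construction (by the reflection `t ↦ −t` we may assume `K_C ≤ K_W`): interpolate the
DERIVATIVES, `ψ₁' := Q_C' + B · (Q_W' − Q_C')` with `B(t) = smoothTransition (t/δ₁)` a smooth
monotone step (`0` on `t ≤ 0`, `1` on `t ≥ δ₁`), and integrate once from `ψ₁(0) = 1` (FTC, the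
primitive of a smooth function is smooth).  Then `ψ₁ = Q_C` on `t ≤ 0`, `ψ₁ = Q_W + γ` on `t ≥ δ₁`
with a constant `γ = O(δ₁)`, and `ψ₁' + 2 K_C t = 2μ_C + B · (Q_W' − Q_C')` is antitone (product of
a nonnegative increasing and a nonpositive decreasing factor on `t ≥ 0`), so `ψ₁'' ≤ −2 K_C`
pointwise.  Finally `ψ := ψ₁ − γ T` with the step `T(t) = smoothTransition (t/δ)`; `|γ T''| < η`
once `δ₁ ≪ δ` (a bound for `T''` on `[−δ, δ]` exists by compactness and `δ₁` is chosen after it).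
The `O(δ)` bound comes from the mean value inequality `|ψ₁ − 1| ≤ sup |ψ₁'| · |t|`.
Everything here is proved from Mathlib; no definitions of record, no named facts.
-/

-- the prescribed namespace `Summit.<P>.<Sub>.…` duplicates `SmoothPoincare4` (P = Sub)
set_option linter.dupNamespace false

open scoped ContDiff Topology

noncomputable section

namespace Summit.SmoothPoincare4.SmoothPoincare4.Theorems.CorkRegluingBudget

open Set

/-! ### Auxiliary one-variable calculus -/

/-- A primitive of a smooth function is smooth and has the integrand as derivative. -/
private lemma primitive_smooth {g : ℝ → ℝ} (hg : ContDiff ℝ ∞ g) (a : ℝ) :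
    ContDiff ℝ ∞ (fun t => ∫ s in a..t, g s) ∧
      ∀ t, HasDerivAt (fun t => ∫ s in a..t, g s) (g t) t := by
  have hd : ∀ t, HasDerivAt (fun t => ∫ s in a..t, g s) (g t) t := fun t =>
    (hg.continuous.integral_hasStrictDerivAt a t).hasDerivAt
  refine ⟨contDiff_infty_iff_deriv.2 ⟨fun t => (hd t).differentiableAt, ?_⟩, hd⟩
  have h : deriv (fun t => ∫ s in a..t, g s) = g := funext fun t => (hd t).deriv
  rw [h]
  exact hg

/-- A rescaled copy of `Real.smoothTransition`: a smooth monotone step which is `0` on `t ≤ 0`,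
`1` on `c ≤ t` and takes values in `[0, 1]`. -/
private lemma step_exists {c : ℝ} (hc : 0 < c) :
    ∃ S : ℝ → ℝ, ContDiff ℝ ∞ S ∧ Monotone S ∧ (∀ t, t ≤ 0 → S t = 0) ∧ (∀ t, c ≤ t → S t = 1) ∧
      (∀ t, 0 ≤ S t) ∧ ∀ t, S t ≤ 1 := by
  refine ⟨fun t => Real.smoothTransition (t / c), ?_, ?_, ?_, ?_, ?_, ?_⟩
  · exact Real.smoothTransition.contDiff.comp (contDiff_id.div_const c)
  · exact fun s t hst => Real.smoothTransition.monotone (div_le_div_of_nonneg_right hst hc.le)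
  · exact fun t ht =>
      Real.smoothTransition.zero_of_nonpos (div_nonpos_of_nonpos_of_nonneg ht hc.le)
  · exact fun t ht => Real.smoothTransition.one_of_one_le ((one_le_div hc).2 ht)
  · exact fun t => Real.smoothTransition.nonneg _
  · exact fun t => Real.smoothTransition.le_one _

/-- A function whose derivative vanishes on a convex set is constant there. -/
private lemma eq_of_hasDerivAt_zero {f f' : ℝ → ℝ} {s : Set ℝ} (hs : Convex ℝ s)
    (hf : ∀ x ∈ s, HasDerivAt f (f' x) x) (hf' : ∀ x ∈ s, f' x = 0) {x y : ℝ} (hx : x ∈ s)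
    (hy : y ∈ s) : f y = f x := by
  have h := hs.norm_image_sub_le_of_norm_hasDerivWithin_le (C := 0)
    (fun x hx => (hf x hx).hasDerivWithinAt) (fun x hx => by simp [hf' x hx]) hx hy
  rw [zero_mul, norm_le_zero_iff, sub_eq_zero] at h
  exact h

/-- The mean value inequality on a convex set, from a pointwise bound on the derivative. -/
private lemma abs_sub_le_of_hasDerivAt {f f' : ℝ → ℝ} {s : Set ℝ} (hs : Convex ℝ s) {C : ℝ}
    (hf : ∀ x ∈ s, HasDerivAt f (f' x) x) (hf' : ∀ x ∈ s, |f' x| ≤ C) {x y : ℝ} (hx : x ∈ s)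
    (hy : y ∈ s) : |f y - f x| ≤ C * |y - x| := by
  have h := hs.norm_image_sub_le_of_norm_hasDerivWithin_le (C := C)
    (fun x hx => (hf x hx).hasDerivWithinAt)
    (fun x hx => (Real.norm_eq_abs _).trans_le (hf' x hx)) hx hy
  simpa only [Real.norm_eq_abs] using h

/-- `|2μ + 2Ks| ≤ 2|μ| + 2|K|δ` whenever `|s| ≤ δ`. -/
private lemma abs_affine_le (μ K : ℝ) {s δ : ℝ} (hs : |s| ≤ δ) :
    |2 * μ + 2 * K * s| ≤ 2 * |μ| + 2 * |K| * δ := by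
  calc |2 * μ + 2 * K * s| ≤ |2 * μ| + |2 * K * s| := abs_add_le _ _
    _ = 2 * |μ| + 2 * |K| * |s| := by simp only [abs_mul, abs_two]
    _ ≤ 2 * |μ| + 2 * |K| * δ := by gcongr

/-- Derivative of the cap profile `Q_C(t) = 1 + 2μt − Kt²`. -/
private lemma hasDerivAt_quadC (μ K t : ℝ) :
    HasDerivAt (fun t : ℝ => 1 + 2 * μ * t - K * t ^ 2) (2 * μ - 2 * K * t) t := by
  have h := (((hasDerivAt_id' t).const_mul (2 * μ)).const_add 1).fun_sub
    ((hasDerivAt_pow 2 t).const_mul K)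
  refine h.congr_deriv ?_
  push_cast
  ring

/-- Derivative of the cork profile `Q_W(t) = 1 − 2μt − Kt²`. -/
private lemma hasDerivAt_quadW (μ K t : ℝ) :
    HasDerivAt (fun t : ℝ => 1 - 2 * μ * t - K * t ^ 2) (-2 * μ - 2 * K * t) t := by
  have h := (((hasDerivAt_id' t).const_mul (2 * μ)).const_sub 1).fun_sub
    ((hasDerivAt_pow 2 t).const_mul K)
  refine h.congr_deriv ?_
  push_cast
  ring

/-! ### The uncorrected smoothed profile

Throughout, `fun t => 2 * μC - 2 * KC * t + B t * (-2 * (μC + μW) - 2 * (KW - KC) * t)` is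
`Q_C' + B · (Q_W' − Q_C')`, the derivative of the uncorrected smoothed profile, for a step `B`
interpolating between the derivatives `Q_C' = 2μ_C − 2K_C t`, `Q_W' = −2μ_W − 2K_W t`. -/

/-- Where `B = 0` (on `t ≤ 0`) a primitive `ψ₁` of `Q_C' + B · (Q_W' − Q_C')` with `ψ₁ 0 = 1` is
the cap profile `Q_C`. -/
private lemma core_left {μC μW KC KW : ℝ} {B ψ₁ : ℝ → ℝ}
    (hd : ∀ t,
      HasDerivAt ψ₁ (2 * μC - 2 * KC * t + B t * (-2 * (μC + μW) - 2 * (KW - KC) * t)) t)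
    (h0 : ψ₁ 0 = 1) (hB0 : ∀ t, t ≤ 0 → B t = 0) {t : ℝ} (ht : t ≤ 0) :
    ψ₁ t = 1 + 2 * μC * t - KC * t ^ 2 := by
  have key : ψ₁ t - (1 + 2 * μC * t - KC * t ^ 2) = ψ₁ 0 - (1 + 2 * μC * 0 - KC * 0 ^ 2) :=
    eq_of_hasDerivAt_zero (convex_Iic 0) (f := fun t => ψ₁ t - (1 + 2 * μC * t - KC * t ^ 2))
      (fun x _ => (hd x).fun_sub (hasDerivAt_quadC μC KC x))
      (fun x hx => by simp only [hB0 x hx]; ring) self_mem_Iic ht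
  rw [h0] at key
  linarith

/-- Where `B = 1` (on `δ₁ ≤ t`) a primitive `ψ₁` of `Q_C' + B · (Q_W' − Q_C')` is the cork
profile `Q_W` up to the constant `ψ₁ δ₁ − Q_W δ₁`. -/
private lemma core_right {μC μW KC KW δ₁ : ℝ} {B ψ₁ : ℝ → ℝ}
    (hd : ∀ t,
      HasDerivAt ψ₁ (2 * μC - 2 * KC * t + B t * (-2 * (μC + μW) - 2 * (KW - KC) * t)) t)
    (hB1 : ∀ t, δ₁ ≤ t → B t = 1) {t : ℝ} (ht : δ₁ ≤ t) :
    ψ₁ t = 1 - 2 * μW * t - KW * t ^ 2 + (ψ₁ δ₁ - (1 - 2 * μW * δ₁ - KW * δ₁ ^ 2)) := by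
  have key : ψ₁ t - (1 - 2 * μW * t - KW * t ^ 2) = ψ₁ δ₁ - (1 - 2 * μW * δ₁ - KW * δ₁ ^ 2) :=
    eq_of_hasDerivAt_zero (convex_Ici δ₁) (f := fun t => ψ₁ t - (1 - 2 * μW * t - KW * t ^ 2))
      (fun x _ => (hd x).fun_sub (hasDerivAt_quadW μW KW x))
      (fun x hx => by simp only [hB1 x hx]; ring) self_mem_Ici ht
  linarith

/-- Pointwise bound on `Q_C' + B · (Q_W' − Q_C')` on `|x| ≤ δ`, for a step `B` with values in
`[0, 1]`. -/
private lemma deriv_bound {μC μW KC KW δ : ℝ} {B : ℝ → ℝ} (hBnn : ∀ t, 0 ≤ B t)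
    (hBle : ∀ t, B t ≤ 1) {x : ℝ} (hx : |x| ≤ δ) :
    |2 * μC - 2 * KC * x + B x * (-2 * (μC + μW) - 2 * (KW - KC) * x)|
      ≤ 2 * (|μC| + |μW|) + 2 * (|KC| + |KW|) * δ := by
  have h1 := abs_affine_le μC (-KC) hx
  have h2 := abs_affine_le μW KW hx
  rw [abs_neg] at h1
  have hB := hBnn x
  have hB' : 0 ≤ 1 - B x := sub_nonneg.2 (hBle x)
  have hδ : 0 ≤ δ := (abs_nonneg x).trans hx
  have hXC : 0 ≤ 2 * |μC| + 2 * |KC| * δ := by positivity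
  have hXW : 0 ≤ 2 * |μW| + 2 * |KW| * δ := by positivity
  calc |2 * μC - 2 * KC * x + B x * (-2 * (μC + μW) - 2 * (KW - KC) * x)|
      = |(1 - B x) * (2 * μC + 2 * (-KC) * x) + B x * (-(2 * μW + 2 * KW * x))| := by
        congr 1; ring
    _ ≤ |(1 - B x) * (2 * μC + 2 * (-KC) * x)| + |B x * (-(2 * μW + 2 * KW * x))| :=
        abs_add_le _ _
    _ = (1 - B x) * |2 * μC + 2 * (-KC) * x| + B x * |2 * μW + 2 * KW * x| := by
        rw [abs_mul, abs_mul, abs_neg, abs_of_nonneg hB', abs_of_nonneg hB]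
    _ ≤ (1 - B x) * (2 * |μC| + 2 * |KC| * δ) + B x * (2 * |μW| + 2 * |KW| * δ) :=
        add_le_add (mul_le_mul_of_nonneg_left h1 hB') (mul_le_mul_of_nonneg_left h2 hB)
    _ ≤ 1 * (2 * |μC| + 2 * |KC| * δ) + 1 * (2 * |μW| + 2 * |KW| * δ) :=
        add_le_add (mul_le_mul_of_nonneg_right (by linarith) hXC)
          (mul_le_mul_of_nonneg_right (hBle x) hXW)
    _ = 2 * (|μC| + |μW|) + 2 * (|KC| + |KW|) * δ := by ring

/-- A primitive `ψ₁` of `Q_C' + B · (Q_W' − Q_C')` with `ψ₁ 0 = 1` stays within `O(|t|)` of `1`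
on `|t| ≤ δ` (mean value inequality). -/
private lemma core_bound {μC μW KC KW δ : ℝ} {B ψ₁ : ℝ → ℝ}
    (hd : ∀ t,
      HasDerivAt ψ₁ (2 * μC - 2 * KC * t + B t * (-2 * (μC + μW) - 2 * (KW - KC) * t)) t)
    (h0 : ψ₁ 0 = 1) (hBnn : ∀ t, 0 ≤ B t) (hBle : ∀ t, B t ≤ 1) {t : ℝ} (ht : |t| ≤ δ) :
    |ψ₁ t - 1| ≤ (2 * (|μC| + |μW|) + 2 * (|KC| + |KW|) * δ) * |t| := by
  have hδ : 0 ≤ δ := (abs_nonneg t).trans ht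
  have key := abs_sub_le_of_hasDerivAt (convex_Icc (-δ) δ) (fun x _ => hd x)
    (fun x hx => deriv_bound hBnn hBle (abs_le.2 hx)) (x := 0) (y := t)
    ⟨by linarith, hδ⟩ (abs_le.1 ht)
  rwa [h0, sub_zero] at key

/-- The concavity estimate `(Q_C' + B · (Q_W' − Q_C'))' ≤ −2 K_C` (for `K_C ≤ K_W`,
`0 ≤ μ_C + μ_W` and a differentiable monotone step `B` vanishing on `t ≤ 0`): the function
`B · (Q_W' − Q_C')` is antitone, hence has nonpositive derivative. -/
private lemma core_second {μC μW KC KW : ℝ} {B : ℝ → ℝ} (hμ : 0 ≤ μC + μW) (hK : KC ≤ KW)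
    (hBm : Monotone B) (hB0 : ∀ t, t ≤ 0 → B t = 0) (hBnn : ∀ t, 0 ≤ B t)
    (hBd : Differentiable ℝ B) (t : ℝ) :
    deriv (fun t => 2 * μC - 2 * KC * t + B t * (-2 * (μC + μW) - 2 * (KW - KC) * t)) t
      ≤ -2 * KC := by
  have hanti : Antitone (fun t => B t * (-2 * (μC + μW) - 2 * (KW - KC) * t)) := by
    intro s u hsu
    dsimp only
    rcases le_or_gt u 0 with hu | hu
    · rw [hB0 u hu, hB0 s (hsu.trans hu), zero_mul, zero_mul]
    · have hDu : -2 * (μC + μW) - 2 * (KW - KC) * u ≤ 0 := by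
        nlinarith [mul_nonneg (sub_nonneg.2 hK) hu.le]
      calc B u * (-2 * (μC + μW) - 2 * (KW - KC) * u)
          ≤ B s * (-2 * (μC + μW) - 2 * (KW - KC) * u) :=
            mul_le_mul_of_nonpos_right (hBm hsu) hDu
        _ ≤ B s * (-2 * (μC + μW) - 2 * (KW - KC) * s) := by
            refine mul_le_mul_of_nonneg_left ?_ (hBnn s)
            nlinarith [mul_le_mul_of_nonneg_left hsu (sub_nonneg.2 hK)]
  have hPd : DifferentiableAt ℝ (fun t => B t * (-2 * (μC + μW) - 2 * (KW - KC) * t)) t := by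
    fun_prop
  have h2 : HasDerivAt (fun t => 2 * μC - 2 * KC * t + B t * (-2 * (μC + μW) - 2 * (KW - KC) * t))
      (-(2 * KC * 1) + deriv (fun t => B t * (-2 * (μC + μW) - 2 * (KW - KC) * t)) t) t :=
    (((hasDerivAt_id' t).const_mul (2 * KC)).const_sub (2 * μC)).fun_add hPd.hasDerivAt
  rw [h2.deriv]
  have h1 : deriv (fun t => B t * (-2 * (μC + μW) - 2 * (KW - KC) * t)) t ≤ 0 :=
    hanti.deriv_nonpos
  linarith

/-! ### The profile -/

/-- The case `K_C ≤ K_W` of `bridge_profile`; the other case follows by `t ↦ −t`. -/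
private theorem bridge_profile_aux (μC μW KC KW δ η : ℝ) (hμ : 0 ≤ μC + μW) (hK : KC ≤ KW)
    (hδ : 0 < δ) (hδ1 : δ ≤ 1) (hη : 0 < η) :
    ∃ ψ : ℝ → ℝ, ContDiff ℝ ∞ ψ ∧
      (∀ t, t ≤ -δ → ψ t = 1 + 2 * μC * t - KC * t ^ 2) ∧
      (∀ t, δ ≤ t → ψ t = 1 - 2 * μW * t - KW * t ^ 2) ∧
      (∀ t, |t| ≤ δ → |ψ t - 1| ≤ (4 * (|μC| + |μW|) + 6 * (|KC| + |KW|)) * δ) ∧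
      (∀ t, |t| ≤ δ → iteratedDeriv 2 ψ t ≤ -2 * KC + η) := by
  -- the correcting step `T` (scale `δ`) and a bound `C` for its second derivative on `[-δ, δ]`
  obtain ⟨T, hTs, -, hT0, hT1, hTnn, hTle⟩ := step_exists hδ
  have hTd : Differentiable ℝ T := (contDiff_infty_iff_deriv.1 hTs).1
  have hT's : ContDiff ℝ ∞ (deriv T) := (contDiff_infty_iff_deriv.1 hTs).2
  have hT'd : Differentiable ℝ (deriv T) := (contDiff_infty_iff_deriv.1 hT's).1
  have hT''s : ContDiff ℝ ∞ (deriv (deriv T)) := (contDiff_infty_iff_deriv.1 hT's).2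
  obtain ⟨C, hC⟩ := (isCompact_Icc (a := -δ) (b := δ)).exists_bound_of_continuousOn
    hT''s.continuous.continuousOn
  -- the inner scale `δ₁`
  set A : ℝ := 4 * (|μC| + |μW|) + 3 * (|KC| + |KW|) with hA
  have hA0 : 0 ≤ A := by positivity
  have hden : 0 < (A + 1) * (|C| + 1) := by positivity
  set δ₁ : ℝ := min (δ / 2) (η / ((A + 1) * (|C| + 1))) with hδ₁
  have hδ₁pos : 0 < δ₁ := lt_min (by linarith) (div_pos hη hden)
  have hδ₁δ : δ₁ ≤ δ / 2 := min_le_left _ _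
  have hδ₁η : δ₁ * ((A + 1) * (|C| + 1)) ≤ η := by
    rw [← le_div_iff₀ hden]
    exact min_le_right _ _
  -- the interpolating step `B` (scale `δ₁`)
  obtain ⟨B, hBs, hBm, hB0, hB1, hBnn, hBle⟩ := step_exists hδ₁pos
  have hBd : Differentiable ℝ B := (contDiff_infty_iff_deriv.1 hBs).1
  -- the uncorrected profile `ψ₁ := Q_C + ∫₀ B · (Q_W' − Q_C')`
  have hBD : ContDiff ℝ ∞ (fun t => B t * (-2 * (μC + μW) - 2 * (KW - KC) * t)) := by
    fun_prop
  obtain ⟨ψ₁, hψ₁s, hψ₁d, hψ₁0⟩ : ∃ ψ₁ : ℝ → ℝ, ContDiff ℝ ∞ ψ₁ ∧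
      (∀ t, HasDerivAt ψ₁ (2 * μC - 2 * KC * t + B t * (-2 * (μC + μW) - 2 * (KW - KC) * t)) t) ∧
      ψ₁ 0 = 1 := by
    obtain ⟨hIs, hId⟩ := primitive_smooth hBD 0
    refine ⟨fun t => (1 + 2 * μC * t - KC * t ^ 2) +
        ∫ s in (0 : ℝ)..t, B s * (-2 * (μC + μW) - 2 * (KW - KC) * s), ?_, ?_, ?_⟩
    · exact (by fun_prop : ContDiff ℝ ∞ fun t : ℝ => 1 + 2 * μC * t - KC * t ^ 2).add hIs
    · exact fun t => (hasDerivAt_quadC μC KC t).add (hId t)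
    · simp
  have hφs :
      ContDiff ℝ ∞ (fun t => 2 * μC - 2 * KC * t + B t * (-2 * (μC + μW) - 2 * (KW - KC) * t)) := by
    fun_prop
  have hφd : Differentiable ℝ
      (fun t => 2 * μC - 2 * KC * t + B t * (-2 * (μC + μW) - 2 * (KW - KC) * t)) :=
    (contDiff_infty_iff_deriv.1 hφs).1
  -- `ψ₁` stays close to `1` on `[-δ, δ]`
  have hM : ∀ t, |t| ≤ δ → |ψ₁ t - 1| ≤ (2 * (|μC| + |μW|) + 2 * (|KC| + |KW|)) * |t| := by
    intro t ht
    refine (core_bound hψ₁d hψ₁0 hBnn hBle ht).trans ?_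
    refine mul_le_mul_of_nonneg_right ?_ (abs_nonneg t)
    nlinarith [abs_nonneg KC, abs_nonneg KW]
  -- the constant `γ := ψ₁ δ₁ − Q_W δ₁` and its size
  set γ : ℝ := ψ₁ δ₁ - (1 - 2 * μW * δ₁ - KW * δ₁ ^ 2) with hγ
  have hγA : |γ| ≤ A * δ₁ := by
    have hδ₁1 : δ₁ ≤ 1 := by linarith
    have hδ₁abs : |δ₁| = δ₁ := abs_of_pos hδ₁pos
    have h1 : |ψ₁ δ₁ - 1| ≤ (2 * (|μC| + |μW|) + 2 * (|KC| + |KW|)) * δ₁ := by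
      have := hM δ₁ (by rw [hδ₁abs]; linarith)
      rwa [hδ₁abs] at this
    have hsq : |KW| * δ₁ ^ 2 ≤ |KW| * δ₁ :=
      mul_le_mul_of_nonneg_left (by nlinarith) (abs_nonneg KW)
    have h2 : |2 * μW * δ₁ + KW * δ₁ ^ 2| ≤ 2 * |μW| * δ₁ + |KW| * δ₁ := by
      calc |2 * μW * δ₁ + KW * δ₁ ^ 2| ≤ |2 * μW * δ₁| + |KW * δ₁ ^ 2| := abs_add_le _ _
        _ = 2 * |μW| * δ₁ + |KW| * δ₁ ^ 2 := by
            simp only [abs_mul, abs_two, abs_pow, hδ₁abs]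
        _ ≤ 2 * |μW| * δ₁ + |KW| * δ₁ := by linarith
    have h3 : γ = (ψ₁ δ₁ - 1) + (2 * μW * δ₁ + KW * δ₁ ^ 2) := by rw [hγ]; ring
    rw [h3, hA]
    refine (abs_add_le _ _).trans ?_
    nlinarith [mul_nonneg (abs_nonneg μC) hδ₁pos.le, mul_nonneg (abs_nonneg KC) hδ₁pos.le]
  have hγη : |γ| * |C| ≤ η := by
    calc |γ| * |C| ≤ (A * δ₁) * |C| := mul_le_mul_of_nonneg_right hγA (abs_nonneg C)
      _ ≤ δ₁ * ((A + 1) * (|C| + 1)) := by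
          nlinarith [abs_nonneg C, hδ₁pos.le, hA0, mul_nonneg hA0 hδ₁pos.le,
            mul_nonneg (abs_nonneg C) hδ₁pos.le]
      _ ≤ η := hδ₁η
  -- the profile `ψ := ψ₁ − γ T`
  set ψ : ℝ → ℝ := fun t => ψ₁ t - γ * T t with hψ
  refine ⟨ψ, hψ₁s.sub (contDiff_const.mul hTs), ?_, ?_, ?_, ?_⟩
  · -- on `t ≤ -δ`: `T = 0` and `ψ₁ = Q_C`
    intro t ht
    have ht0 : t ≤ 0 := by linarith
    simp only [hψ]
    rw [hT0 t ht0, mul_zero, sub_zero]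
    exact core_left hψ₁d hψ₁0 hB0 ht0
  · -- on `δ ≤ t`: `T = 1` and `ψ₁ = Q_W + γ`
    intro t ht
    have h := core_right hψ₁d hB1 (t := t) (by linarith)
    simp only [hψ]
    rw [hT1 t ht, mul_one]
    linarith [h, hγ]
  · -- `|ψ - 1| = O(δ)` on `|t| ≤ δ`
    intro t ht
    simp only [hψ]
    have h1 := hM t ht
    have hTabs : |T t| ≤ 1 := abs_le.2 ⟨by linarith [hTnn t], hTle t⟩
    have hγT : |γ * T t| ≤ A * (δ / 2) := by
      rw [abs_mul]
      calc |γ| * |T t| ≤ |γ| * 1 := mul_le_mul_of_nonneg_left hTabs (abs_nonneg γ)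
        _ ≤ A * δ₁ := by rw [mul_one]; exact hγA
        _ ≤ A * (δ / 2) := mul_le_mul_of_nonneg_left hδ₁δ hA0
    have htri : |ψ₁ t - γ * T t - 1| ≤ |ψ₁ t - 1| + |γ * T t| := by
      rw [show ψ₁ t - γ * T t - 1 = (ψ₁ t - 1) - γ * T t by ring]
      exact abs_sub _ _
    have e1 : (2 * (|μC| + |μW|) + 2 * (|KC| + |KW|)) * |t|
        ≤ (2 * (|μC| + |μW|) + 2 * (|KC| + |KW|)) * δ :=
      mul_le_mul_of_nonneg_left ht (by positivity)
    have e2 : 0 ≤ (|KC| + |KW|) * δ := by positivity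
    rw [hA] at hγT
    linarith
  · -- `ψ'' ≤ -2 K_C + η` on `|t| ≤ δ`
    intro t ht
    have hmem : t ∈ Icc (-δ) δ := abs_le.1 ht
    have hψd : ∀ x, HasDerivAt ψ
        (2 * μC - 2 * KC * x + B x * (-2 * (μC + μW) - 2 * (KW - KC) * x) - γ * deriv T x) x :=
      fun x => (hψ₁d x).fun_sub ((hTd x).hasDerivAt.const_mul γ)
    have hderiv : deriv ψ = fun x =>
        2 * μC - 2 * KC * x + B x * (-2 * (μC + μW) - 2 * (KW - KC) * x) - γ * deriv T x :=
      funext fun x => (hψd x).deriv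
    have hψdd : HasDerivAt
        (fun x => 2 * μC - 2 * KC * x + B x * (-2 * (μC + μW) - 2 * (KW - KC) * x) - γ * deriv T x)
        (deriv (fun t => 2 * μC - 2 * KC * t + B t * (-2 * (μC + μW) - 2 * (KW - KC) * t)) t
          - γ * deriv (deriv T) t) t :=
      (hφd t).hasDerivAt.fun_sub ((hT'd t).hasDerivAt.const_mul γ)
    rw [iteratedDeriv_succ, iteratedDeriv_one, hderiv, hψdd.deriv]
    have h1 := core_second hμ hK hBm hB0 hBnn hBd t
    have h2 : |deriv (deriv T) t| ≤ |C| :=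
      ((Real.norm_eq_abs _).symm.trans_le (hC t hmem)).trans (le_abs_self C)
    have h3 : -(γ * deriv (deriv T) t) ≤ |γ| * |C| := by
      calc -(γ * deriv (deriv T) t) ≤ |γ * deriv (deriv T) t| := neg_le_abs _
        _ = |γ| * |deriv (deriv T) t| := abs_mul _ _
        _ ≤ |γ| * |C| := mul_le_mul_of_nonneg_left h2 (abs_nonneg γ)
    linarith

/-- **BR1a — the mollified concave bridge profile** (registered sub-goal `bridge_profile` of
`stub_warpedBridge`, crux `CorkRegluingBudget`, line `registered` RESHAPE 3).  For constants
`μ_C, μ_W, K_C, K_W` with `μ_C + μ_W ≥ 0`, a width `0 < δ ≤ 1` and a tolerance `η > 0` there is a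
smooth `ψ : ℝ → ℝ` which equals `1 + 2μ_C t − K_C t²` for `t ≤ −δ` and `1 − 2μ_W t − K_W t²` for
`t ≥ δ`, stays within `(4(|μ_C| + |μ_W|) + 6(|K_C| + |K_W|))·δ` of `1` on `|t| ≤ δ`, and has second
derivative `≤ −2 min(K_C, K_W) + η` on `|t| ≤ δ`.  See the module docstring for the construction.
[folklore] -/
theorem bridge_profile :
    ∀ (μC μW KC KW δ η : ℝ), 0 ≤ μC + μW → 0 < δ → δ ≤ 1 → 0 < η →
      ∃ ψ : ℝ → ℝ, ContDiff ℝ ∞ ψ ∧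
        (∀ t, t ≤ -δ → ψ t = 1 + 2 * μC * t - KC * t ^ 2) ∧
        (∀ t, δ ≤ t → ψ t = 1 - 2 * μW * t - KW * t ^ 2) ∧
        (∀ t, |t| ≤ δ → |ψ t - 1| ≤ (4 * (|μC| + |μW|) + 6 * (|KC| + |KW|)) * δ) ∧
        (∀ t, |t| ≤ δ → iteratedDeriv 2 ψ t ≤ -2 * min KC KW + η) := by
  intro μC μW KC KW δ η hμ hδ hδ1 hη
  rcases le_total KC KW with hK | hK
  · obtain ⟨ψ, h1, h2, h3, h4, h5⟩ := bridge_profile_aux μC μW KC KW δ η hμ hK hδ hδ1 hη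
    exact ⟨ψ, h1, h2, h3, h4, fun t ht => by rw [min_eq_left hK]; exact h5 t ht⟩
  · -- reflect `t ↦ -t`, which swaps the roles of the cap and the cork side
    obtain ⟨ψ, h1, h2, h3, h4, h5⟩ :=
      bridge_profile_aux μW μC KW KC δ η (by linarith) hK hδ hδ1 hη
    refine ⟨fun t => ψ (-t), h1.comp contDiff_neg, fun t ht => ?_, fun t ht => ?_,
      fun t ht => ?_, fun t ht => ?_⟩
    · show ψ (-t) = 1 + 2 * μC * t - KC * t ^ 2
      rw [h3 (-t) (by linarith)]
      ring
    · show ψ (-t) = 1 - 2 * μW * t - KW * t ^ 2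
      rw [h2 (-t) (by linarith)]
      ring
    · show |ψ (-t) - 1| ≤ (4 * (|μC| + |μW|) + 6 * (|KC| + |KW|)) * δ
      exact (h4 (-t) (by simpa using ht)).trans_eq (by ring)
    · have h := h5 (-t) (by simpa using ht)
      rw [iteratedDeriv_comp_neg, min_eq_right hK]
      simpa using h


end Summit.SmoothPoincare4.SmoothPoincare4.Theorems.CorkRegluingBudget

end
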